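import Summits.CriticalPhenomena.PercolationContinuityZ3.Theses.PercLowPointHalfSpace

/-!
# Sketch (ideator 3, gen 2) — typed statements behind `MEMO-ideator3-g2.md` for crux
`BoundaryTwoArmDecay` (stmt-CriticalPhenomena-0911)

Self-contained (re-declares the handful of definitions of gen-1's `Sketch-ideator3.lean`, namespace
`StapleCensus`, that it needs). Nothing is proved; everything must elaborate.

Contents
* `massBelow`, `sliceMass`, `sealWeight` — one-cluster functionals of `U = C_ℍ(0)`;
* `s2Dens s`  = `E[ |U ∩ {x₀ < s}|² · (1-p_c)^{|U ∩ ∂ℍ|} · 1{U reaches height s} / |U ∩ ∂ℍ| ]`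
  (sealed tall second moment, per floor site) and `leakDens s` (mass × top-slice leakage);
* `kissMassMoment s` = `E[ 1{kissV s} · |U(0) ∩ {x₀<s}| · |U(e) ∩ {x₀<s}| ]` (the assembly's cross-bush
  weight at an adjacent-root kiss);
* `MassSquaredCensus m₀` — the QUADRATIC balance law of the level census (memo §3):
  `p_c³ · kissMassMoment ≤ m₀ · (s2Dens + 2 leakDens)`;
* `SealedTallSecondMoment κ` — candidate MERGED route item `S2(κ)` replacing cruxes A and B:
  `s2Dens s + leakDens s ≤ C s^{3-κ}` (truth ≈ s^{2.04+ψ}, MC j013914);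
* `DownConnectionIdentity` — `P((m,0,0) ↔_ℍ ∂ℍ) = E[ |U ∩ {x₀ = m}| / |U ∩ ∂ℍ| ]` (memo §5, provable now
  by the same horizontal mass transport as `LowPointIdentity`).
-/

noncomputable section

namespace Summit.CriticalPhenomena.PercolationContinuityZ3.Cruxes.BoundaryTwoArmDecay.MassCensus

open MeasureTheory Literature.Probability.LatticeModels Literature.Probability.Percolation

/-- Critical bond percolation on `ℤ³`. -/
abbrev P : Measure (BondConfig (Site 3)) := bondPercolation (zdGraph 3) (criticalProbI 3)

/-- `p_c(ℤ³)` as a real number. -/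
abbrev pc : ℝ := ((criticalProbI 3 : unitInterval) : ℝ)

/-- Floor direction `e = (0,1,0)`. -/
abbrev e : Site 3 := Pi.single 1 1

/-- The half-space above level `l`; `up 0 = halfSpace 3 = {x | 0 ≤ x 0}`. -/
def up (l : ℤ) : Set (Site 3) := {x | l ≤ x 0}

/-- The level-`l` component of `x` reaches height `l + n`. -/
def heightGE (l : ℤ) (x : Site 3) (n : ℕ) : Set (BondConfig (Site 3)) :=
  {ω | ∃ y : Site 3, l + (n : ℤ) ≤ y 0 ∧ ω ∈ openConnIn (up l) x y}

/-- Vertical-reach kiss at level `l` rooted at `x` in direction `e` (gen-1's `kissV`). -/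
def kissV (l : ℤ) (x : Site 3) (n : ℕ) : Set (BondConfig (Site 3)) :=
  heightGE l x n ∩ heightGE l (x + e) n ∩ (openConnIn (up l) x (x + e))ᶜ

/-- Half-space cluster of an arbitrary floor point `x` (the tree's `halfSpaceCluster` is `x = 0`). -/
def halfSpaceClusterAt (x : Site 3) (ω : BondConfig (Site 3)) : Set (Site 3) :=
  {v | ω ∈ openConnIn (halfSpace 3) x v}

/-- Mass of `U(x)` strictly below height `s` (the first `s` levels above the floor). -/
def massBelowAt (x : Site 3) (s : ℕ) (ω : BondConfig (Site 3)) : ℕ∞ :=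
  (halfSpaceClusterAt x ω ∩ {v | v 0 < (s : ℤ)}).encard

/-- Mass of `U = U(0)` strictly below height `s`. -/
def massBelow (s : ℕ) (ω : BondConfig (Site 3)) : ℕ∞ :=
  (halfSpaceCluster ω ∩ {v | v 0 < (s : ℤ)}).encard

/-- Slice mass of `U` at height exactly `h`. -/
def sliceMass (h : ℕ) (ω : BondConfig (Site 3)) : ℕ∞ :=
  (halfSpaceCluster ω ∩ {v | v 0 = (h : ℤ)}).encard

/-- Sealing weight `(1 - p_c)^{|U ∩ ∂ℍ|}`: the probability, given `U`, that every (fictitious) down-edge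
from its footprint is closed — the weight with which a tall component DIES in the level census.
(`toNat` sends an infinite footprint to weight `1`; the footprint is a.s. finite by BGN.) -/
def sealWeight (ω : BondConfig (Site 3)) : ENNReal :=
  (ENNReal.ofReal (1 - pc)) ^ (halfSpaceFootprint ω).toNat

/-- `s2Dens s := E[ |U ∩ {x₀<s}|² (1-p_c)^{|U∩∂ℍ|} 1{U reaches height s} / |U ∩ ∂ℍ| ]` — by horizontal
mass transport the per-floor-site density of SEALED tall clusters weighted by mass². -/
def s2Dens (s : ℕ) : ENNReal :=
  ∫⁻ ω, (heightGE 0 0 s).indicator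
    (fun ω => sealWeight ω * ((massBelow s ω : ℕ∞) : ENNReal) ^ 2 *
      ((halfSpaceFootprint ω : ℕ∞) : ENNReal)⁻¹) ω ∂P

/-- Leakage of the quadratic census (top layer lost when the floor is lowered by one level):
`leakDens s := E[ |U ∩ {x₀<s}| · |U ∩ {x₀ = s-1}| · 1{U reaches height s} / |U ∩ ∂ℍ| ]`. -/
def leakDens (s : ℕ) : ENNReal :=
  ∫⁻ ω, (heightGE 0 0 s).indicator
    (fun ω => ((massBelow s ω : ℕ∞) : ENNReal) * ((sliceMass (s - 1) ω : ℕ∞) : ENNReal) *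
      ((halfSpaceFootprint ω : ℕ∞) : ENNReal)⁻¹) ω ∂P

/-- The kiss–mass moment at the adjacent floor pair `(0, e)`: the cross-bush weight that the route's
Assembly attaches to a kiss (w-averaged low-point identity, memo §3). -/
def kissMassMoment (s : ℕ) : ENNReal :=
  ∫⁻ ω, (kissV 0 0 s).indicator
    (fun ω => ((massBelowAt 0 s ω : ℕ∞) : ENNReal) * ((massBelowAt e s ω : ℕ∞) : ENNReal)) ω ∂P

/-- QUADRATIC CENSUS (memo §3): for the stationary quadratic population functional
`Φ_l = Σ_{W ∈ pop_l} |W ∩ [l, l+s)|²` one level step gives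
`2·E[Σ_merging pairs (a_i - t_i)(a_j - t_j)] ≤ E[Σ_sealed a²] + 2·E[Σ a_W t_W]`, and a stapled kiss is
a merger (factor `p_c³`, kiss points per merger `≤ m₀`). Stated as the resulting inequality. -/
def MassSquaredCensus (m₀ : ℕ → ℝ) : Prop :=
  ∀ s : ℕ, 1 ≤ s →
    pc ^ 3 * (kissMassMoment s).toReal ≤ m₀ s * ((s2Dens s).toReal + 2 * (leakDens s).toReal)

/-- CANDIDATE MERGED ITEM `S2(κ)` (route level, replacing A = `BoundaryTwoArmDecay` and
B = `TallClusterMassBound` in the cross-bush bookkeeping): sealed tall second moment + leakage grow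
slower than `s³`. Truth (hyperscaling): `≈ s^{2 d_f - 3 + ψ} ≈ s^{2.04 + ψ}`. -/
def SealedTallSecondMoment (κ : ℝ) : Prop :=
  ∃ C : ℝ, ∀ s : ℕ, 1 ≤ s →
    (s2Dens s).toReal + (leakDens s).toReal ≤ C * (s : ℝ) ^ (3 - κ)

/-- DOWN-CONNECTION IDENTITY (memo §5): the probability that the point at depth `m` above the floor is
joined to the floor inside `ℍ` equals the expected slice-mass / footprint of the floor cluster. -/
def DownConnectionIdentity : Prop :=
  ∀ m : ℕ,
    P {ω | ∃ y : Site 3, y 0 = 0 ∧ ω ∈ openConnIn (halfSpace 3) (Pi.single 0 (m : ℤ)) y} =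
      ∫⁻ ω, ((sliceMass m ω : ℕ∞) : ENNReal) * ((halfSpaceFootprint ω : ℕ∞) : ENNReal)⁻¹ ∂P

/-- What the memo claims the merged item buys (route level; bookkeeping as in the spine card's
AssemblyLemma with the w-AVERAGED identity): quadratic census + S2 + kiss multiplicity control the
cross-bush term without A or B. Recorded as a shape only. -/
def MergedBookkeepingShape : Prop :=
  ∀ κ : ℝ, 0 < κ → ∀ m₀ : ℕ → ℝ,
    (∃ C : ℝ, ∀ s : ℕ, 1 ≤ s → m₀ s ≤ C * (s : ℝ) ^ (κ / 2)) →
    MassSquaredCensus m₀ → SealedTallSecondMoment κ →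
      ∃ C : ℝ, ∀ s : ℕ, 1 ≤ s → (kissMassMoment s).toReal ≤ C * (s : ℝ) ^ (3 - κ / 2)

end Summit.CriticalPhenomena.PercolationContinuityZ3.Cruxes.BoundaryTwoArmDecay.MassCensus

end
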